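import Mathlib
import HarnessLib

/-! # Stub `stub_squareParityCore` (line `local_clause_cut`, crux `EmptyWeightCore`, stmt-Langlands-17008)

The purely group-theoretic core of the local parity lemma of the crux.  In the application
`G = Γ_K` is the absolute Galois group of a `p`-adic field, `I` is inertia, `P ⊆ I` is wild
inertia (pro-`p`, so every element of `P` is a square), `φ` is an arithmetic Frobenius
(`φ σ φ⁻¹ ≡ σ ^ p (mod P)` for `σ ∈ I`), `ω : G →* (ℤ/p)ˣ` is the mod-`p` cyclotomic character
(trivial on `P`, surjective onto `𝔽_pˣ` on `I`), and `χ : G →* kˣ` is an abstract character with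
`χ² = ι(ω)ⁿ` on `I`.  Conclusion: `n` is even.

Proof.  For `σ ∈ I` the element `π := φ σ φ⁻¹ (σ ^ p)⁻¹` lies in `P`, so `π = y²` with
`y ∈ P ⊆ I`, whence `χ π = (χ y)² = ι(ω y)ⁿ = 1`; as `kˣ` is commutative this reads
`χ σ = (χ σ) ^ p`, i.e. `(χ σ) ^ (p - 1) = 1`.  At a `σ₀ ∈ I` with `ω σ₀` a primitive
`(p - 1)`-st root of unity, `g := ι(ω σ₀)` is a primitive `(p - 1)`-st root of unity in `k`,
so `χ σ₀ = g ^ j`, and `g ^ (2j) = (χ σ₀)² = g ^ n` gives `(p - 1) ∣ 2j - n`; since `p` is odd,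
`2 ∣ p - 1`, hence `2 ∣ n`.
-/

set_option linter.dupNamespace false

namespace Summit.Langlands.Langlands.Cruxes.EmptyWeightCore.LocalClauseCut

/-- **Parity core.**  Let `P ≤ I` be subgroups of a group `G` with every element of `P` a square
in `P`, let `φ : G` satisfy `φ σ φ⁻¹ (σ ^ p)⁻¹ ∈ P` for all `σ ∈ I` (`p` an odd prime), let
`ω : G →* (ℤ/p)ˣ` be trivial on `P` and hit a generator of `𝔽_pˣ` on `I`, and let
`χ : G →* kˣ` (`k` a field, `ι : ℤ/p →+* k`) satisfy `(χ σ)² = ι(ω σ) ^ n` on `I` for an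
integer `n`.  Then `n` is even. [folklore] -/
theorem stub_squareParityCore :
    ∀ (G : Type) [Group G] (I P : Subgroup G) (φ : G) (p : ℕ) [Fact p.Prime], p ≠ 2 → P ≤ I →
      (∀ π ∈ P, ∃ y ∈ P, y * y = π) →
      (∀ σ ∈ I, φ * σ * φ⁻¹ * (σ ^ p)⁻¹ ∈ P) →
      ∀ (ω : G →* (ZMod p)ˣ), (∀ σ ∈ P, ω σ = 1) →
        (∃ σ₀ ∈ I, IsPrimitiveRoot ((ω σ₀ : (ZMod p)ˣ) : ZMod p) (p - 1)) →
        ∀ (k : Type) [Field k] (ι : ZMod p →+* k) (χ : G →* kˣ) (n : ℤ),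
          (∀ σ ∈ I, ((χ σ : kˣ) : k) ^ 2 = ι ((ω σ : (ZMod p)ˣ) : ZMod p) ^ n) →
          Even n := by
  intro G _ I P φ p hp hp2 hPI hsq hfrob ω hωP hσ₀ k _ ι χ n hχ
  obtain ⟨σ₀, hσ₀I, hprim⟩ := hσ₀
  have hp1 : 2 ≤ p := hp.out.two_le
  -- Steps (a)+(b): `χ σ ^ p = χ σ` for every `σ ∈ I`.
  have key : ∀ σ ∈ I, χ σ ^ p = χ σ := by
    intro σ hσ
    obtain ⟨y, hyP, hy⟩ := hsq _ (hfrob σ hσ)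
    have h2 : χ (φ * σ * φ⁻¹ * (σ ^ p)⁻¹) = 1 := by
      rw [← hy, map_mul, ← Units.val_eq_one, Units.val_mul, ← sq, hχ y (hPI hyP), hωP y hyP,
        Units.val_one, map_one, one_zpow]
    simp only [map_mul, map_inv, map_pow] at h2
    rw [mul_inv_cancel_comm, mul_inv_eq_one] at h2
    exact h2.symm
  -- Step (c): `χ σ₀` is a power of the primitive root `g := ι (ω σ₀)`.
  set g : k := ι ((ω σ₀ : (ZMod p)ˣ) : ZMod p)
  have hprimk : IsPrimitiveRoot g (p - 1) := hprim.map_of_injective ι.injective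
  haveI : NeZero (p - 1) := ⟨by omega⟩
  have hc : ((χ σ₀ : kˣ) : k) ^ (p - 1) = 1 := by
    have h := key σ₀ hσ₀I
    rw [← pow_sub_one_mul (by omega : p ≠ 0), mul_eq_right] at h
    rw [← Units.val_pow_eq_pow_val, h, Units.val_one]
  obtain ⟨j, -, hjc⟩ := hprimk.eq_pow_of_pow_eq_one hc
  -- Step (d): compare exponents.
  have h3 := hχ σ₀ hσ₀I
  rw [← hjc, ← pow_mul] at h3
  have hg0 : g ≠ 0 := hprimk.ne_zero (by omega)
  have h4 : g ^ (((j * 2 : ℕ) : ℤ) - n) = 1 := by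
    rw [zpow_sub₀ hg0, zpow_natCast, h3, div_self (zpow_ne_zero n hg0)]
  rw [hprimk.zpow_eq_one_iff_dvd] at h4
  have h5 : (2 : ℤ) ∣ ((p - 1 : ℕ) : ℤ) := by
    exact_mod_cast (hp.out.even_sub_one hp2).two_dvd
  have h6 := h5.trans h4
  push_cast at h6
  rw [even_iff_two_dvd]
  omega

end Summit.Langlands.Langlands.Cruxes.EmptyWeightCore.LocalClauseCut
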